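import Summits.BirchSwinnertonDyer.BirchSwinnertonDyer.Theses.TameQuarticManinParity
import Summits.BirchSwinnertonDyer.BirchSwinnertonDyer.Theorems.ManinLocalTwoThreeConwayDepthTransfer
import Summits.BirchSwinnertonDyer.BirchSwinnertonDyer.Theorems.ManinLocalTwoThreeLineIndexFinite
import Literature.NumberTheory.EllipticCurves.AtkinLehnerInvolutionsNewformProofs
import Literature.NumberTheory.EllipticCurves.ManinConstantClassCertificateTwist
import HarnessLib

/-!
# Route `TameQuarticManinParity`, LINE 43 (bsd-idea-3 g12): the support DL3 `TprimeALCutCongruenceWitnessAtThree`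
# (stmt-BirchSwinnertonDyer-24163) ⟸ the desc cell's candidate E-desc-23 `ALStableDepthLaw`, BY NAME
# («the line index is attained»; `--supports` 24163 — CONDITIONAL on the `@[conjecture]` E-desc-23, closes nothing)

Cell `pub/bsd-wall`, D-0145 line `route-BirchSwinnertonDyer-TeichmullerTwistDescent`, seat `bsd-line-ttd-p1` g15.
BSD is NOT proved by this; Manin's conjecture is not proved by this; DL3 stays OPEN (its hypothesis here,
`Summit.BirchSwinnertonDyer.Rank1Residual.ManinAdditive.ALStableDepthLaw`, is the bsd-f2-manin desc cell's
`@[conjecture]` E-desc-23 — census 59/59, not in print). THEOREMS ONLY; no definition, no named fact, no `sorry`.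

## Proof (the planner's informal for 24163, made formal)

For `W` in the (t′) cell (`Addv W 3`, so `9 ∣ N`) with a lattice-optimal, degree-minimal datum `D`: E-desc-23 at `p = 3`
gives `3^{v₃ deg φ} ∣ r := lineIndex S^{AL} f`; `f ∈ S^{AL}` by the PROVED Knapp 9.27 (b)
(`IsNewform0.exists_atkinLehnerInvolutionAt_eq_smul_holds`, `f_mem_alStableLattice`), so `r ≠ 0`
(`lineIndex_ne_zero_of_mem`) and the line index is ATTAINED (`exists_mem_petersson_eq_of_lineIndex_ne_zero`,
ManinLocalTwoThree): some `h ∈ S^{AL}` has `r·⟨f,h⟩ = ⟨f,f⟩`. Then `M := S^{AL}` (integral, AL-stable: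
`alStableLattice_le`, `alStableLattice_map_le`), `h`, `t := 1/r` (`v₃ t = −v₃ r ≤ −v₃ deg φ`) is the DL3 witness.
Axioms `propext`, `Classical.choice`, `Quot.sound`.
-/

set_option autoImplicit false
-- D-0017: single-problem summit, so `Summit.BirchSwinnertonDyer.BirchSwinnertonDyer.…` repeats a namespace BY DESIGN.
set_option linter.dupNamespace false

noncomputable section

namespace Summit.BirchSwinnertonDyer.BirchSwinnertonDyer.Theorems.TameQuarticManinParity

open scoped MatrixGroups ModularForm
open CongruenceSubgroup
open Summit.BirchSwinnertonDyer.BirchSwinnertonDyer.Theses.TameQuarticManinParity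
open Literature.NumberTheory.EllipticCurves Literature.NumberTheory.EllipticCurves.ModularForms
open Summit.BirchSwinnertonDyer.Rank1Residual.ManinAdditive
open Summit.BirchSwinnertonDyer.BirchSwinnertonDyer.Theorems.ManinLocalTwoThree

/-- **DL3 from E-desc-23** (`ALStableDepthLaw`): the AL-stable congruence witness of depth `v₃(deg φ)` at `3` on the
tame (t′) cells, with `M = S^{AL}`, `t = 1/lineIndex S^{AL} f`. [cite: AgasheRibetStein2012, Thm. 2.1 (shape)]
[cite: Knapp1993, Thm. 9.27(b)] -/
theorem tprimeALCutCongruenceWitnessAtThree_of_alStableDepthLaw (h23 : ALStableDepthLaw) :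
    TprimeALCutCongruenceWitnessAtThree := by
  unfold TprimeALCutCongruenceWitnessAtThree
  intro W _ _ _ hadd _ht D hopt hmin
  haveI : Fact (Nat.Prime 3) := ⟨Nat.prime_three⟩
  have h9 : 3 ^ 2 ∣ W.conductorNorm ℤ := sq_dvd_conductorNorm_of_not_good_of_not_mult hadd
  -- E-desc-23 at `p = 3`
  have hdvd : 3 ^ padicValNat 3 D.modularDegree ∣ lineIndex (alStableLattice (W.conductorNorm ℤ)) D.f :=
    h23 W D hopt hmin 3 Nat.prime_three h9
  -- `f ∈ S^{AL}` (Knapp 9.27 (b), proved), so the index is finite and attained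
  have hfM : D.f ∈ alStableLattice (W.conductorNorm ℤ) :=
    f_mem_alStableLattice D IsNewform0.exists_atkinLehnerInvolutionAt_eq_smul_holds
  have hr : lineIndex (alStableLattice (W.conductorNorm ℤ)) D.f ≠ 0 :=
    lineIndex_ne_zero_of_mem D alStableLattice_le hfM
  have hff : peterssonProduct (Gamma0 (W.conductorNorm ℤ)) 2 D.f D.f ≠ 0 := by
    intro h0
    have hpos := peterssonProduct_self_pos_holds (Gamma0 (W.conductorNorm ℤ)) 2
      (IsNormalized.ne_zero D.isNewformOf.1.2.2)
    rw [h0, Complex.zero_re] at hpos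
    exact lt_irrefl _ hpos
  obtain ⟨h, hh, hθ⟩ :=
    exists_mem_petersson_eq_of_lineIndex_ne_zero (alStableLattice (W.conductorNorm ℤ)) D.f hfM hff hr
  set r := lineIndex (alStableLattice (W.conductorNorm ℤ)) D.f with hrdef
  have hrQ : (r : ℚ) ≠ 0 := by exact_mod_cast hr
  refine ⟨alStableLattice (W.conductorNorm ℤ), alStableLattice_le, fun p hp hpN ↦ alStableLattice_map_le p hp hpN,
    h, hh, (r : ℚ)⁻¹, inv_ne_zero hrQ, ?_, ?_⟩
  · -- `v₃(1/r) = −v₃ r ≤ −v₃ deg φ`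
    rw [padicValRat.inv, padicValRat.of_nat]
    have hδ : padicValNat 3 D.modularDegree ≤ padicValNat 3 r :=
      (padicValNat_dvd_iff_le hr).mp hdvd
    have : ((padicValNat 3 D.modularDegree : ℕ) : ℤ) ≤ padicValNat 3 r := by exact_mod_cast hδ
    linarith
  · -- `⟨f,h⟩ = (1/r)⟨f,f⟩`
    have hrC : (r : ℂ) ≠ 0 := by exact_mod_cast hr
    rw [Rat.cast_inv, Rat.cast_natCast, eq_inv_mul_iff_mul_eq₀ hrC]
    exact hθ

end Summit.BirchSwinnertonDyer.BirchSwinnertonDyer.Theorems.TameQuarticManinParity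

end
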